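import Literature.Analysis.FluidPDE.ElgindiDistributionalRegularity
import HarnessLib

/-!
# Classical strip solutions are distributional solutions; limits of solutions
([Elgindi2021] §7.1 Proposition 7.1, §7.5 Theorem 2 — passage to the limit in the data)

Topic `Literature/Analysis/FluidPDE`. Proof file (everything proved, no definitions, no named
facts) on the proof path of the named fact
`Literature.Analysis.FluidPDE.Elgindi.ElgindiGhoulMasmoudi2021_stabilityCore`
(`ElgindiStabilityDecomposition.lean`). T. M. Elgindi, Ann. of Math. 194 (2021) =
arXiv:1904.04795, §7.1 (p. 19), §7.5 (p. 24).

A function smooth on the strip with `LΨ = F` there satisfies `∫∫Ψ·ᵗLΦ = ∫∫F·Φ` for every smooth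
`Φ` compactly supported in the open strip (`integral_classical_transposeOp`); and the
distributional identity passes to `L²(strip)`-limits of solutions and data
(`distrib_of_tendsto`), so that limits of classical solutions have smooth representatives solving
the limit equation (`exists_smooth_limit_solution`).
-/

noncomputable section

open MeasureTheory Set Function Real Filter
open _root_.Topology
open scoped ENNReal ContDiff InnerProductSpace

namespace Literature.Analysis.FluidPDE

namespace Elgindi

/-! ### Classical solutions are distributional solutions -/

/-- **`∫∫_strip Ψ·ᵗL(Φ) = ∫∫_strip (LΨ)·Φ`** for `Ψ ∈ C^∞(strip)` and a test function `Φ`. [folklore] -/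
theorem integral_strip_mul_transposeOp {α : ℝ} {Ψ : ℝ × ℝ → ℝ} (hΨ : ContDiffOn ℝ ∞ Ψ strip)
    {Φ : ℝ → ℝ → ℝ} (hΦn : ∀ n : ℕ, ContDiff ℝ n (uncurry Φ)) (hΦs : HasCompactSupport (uncurry Φ)) (hΦS : tsupport (uncurry Φ) ⊆ strip) :
    ∫ p in strip, Ψ p * transposeOp α Φ p = ∫ p in strip, ellipticOp α (fun R θ => Ψ (R, θ)) p.1 p.2 * Φ p.1 p.2 := by
  obtain ⟨W, Ψt, hW, hKW, hWS, hΨt, hΨts, hΨtS, hEq⟩ := exists_test_eqOn hΨ hΦs.isCompact hΦS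
  set Ψtc : ℝ → ℝ → ℝ := fun R θ => Ψt (R, θ) with hΨtc
  have eut : uncurry Ψtc = Ψt := by funext q; rfl
  have hΨtn : ∀ n : ℕ, ContDiff ℝ n (uncurry Ψtc) := fun n => by rw [eut]; exact hΨt.of_le (by exact_mod_cast (le_top : (n : ℕ∞) ≤ ⊤))
  have hΨts' : HasCompactSupport (uncurry Ψtc) := by rw [eut]; exact hΨts
  have hΨtS' : tsupport (uncurry Ψtc) ⊆ strip := by rw [eut]; exact hΨtS
  have h0 : ∀ p, p ∉ tsupport (uncurry Φ) → Φ p.1 p.2 = 0 := fun p hp => image_eq_zero_of_notMem_tsupport (f := uncurry Φ) hp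
  have e1 : ∫ p in strip, Ψ p * transposeOp α Φ p = ∫ p in strip, Ψtc p.1 p.2 * transposeOp α Φ p := by
    refine setIntegral_congr_fun measurableSet_strip fun p _ => ?_
    by_cases hps : p ∈ tsupport (uncurry Φ)
    · show _ = Ψt (p.1, p.2) * _; rw [hEq (hKW hps)]
    · rw [transposeOp_eq_zero_of_notMem α hps, mul_zero, mul_zero]
  have e2 : ∫ p in strip, ellipticOp α (fun R θ => Ψ (R, θ)) p.1 p.2 * Φ p.1 p.2 = ∫ p in strip, ellipticOp α Ψtc p.1 p.2 * Φ p.1 p.2 := by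
    refine setIntegral_congr_fun measurableSet_strip fun p _ => ?_
    by_cases hps : p ∈ tsupport (uncurry Φ)
    · rw [eqOn_ellipticOp α hW (f := fun R θ => Ψ (R, θ)) (g := Ψtc) (fun r hr => by show Ψ (r.1, r.2) = Ψt (r.1, r.2); exact (hEq hr).symm) (hKW hps)]
    · rw [h0 p hps, mul_zero, mul_zero]
  rw [e1, e2, integral_ellipticOp_mul_test α hΨtn hΨts' hΨtS' hΦn hΦs hΦS]

/-- **Classical strip solutions are distributional solutions**: if `LΨ = F` on the strip then
`∫∫Ψ·ᵗLΦ = ∫∫F·Φ` for all test functions `Φ`. [folklore] -/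
theorem integral_classical_transposeOp {α : ℝ} {Ψ : ℝ × ℝ → ℝ} (hΨ : ContDiffOn ℝ ∞ Ψ strip) {F : ℝ × ℝ → ℝ}
    (heq : ∀ p ∈ strip, ellipticOp α (fun R θ => Ψ (R, θ)) p.1 p.2 = F p)
    {Φ : ℝ → ℝ → ℝ} (hΦn : ∀ n : ℕ, ContDiff ℝ n (uncurry Φ)) (hΦs : HasCompactSupport (uncurry Φ)) (hΦS : tsupport (uncurry Φ) ⊆ strip) :
    ∫ p in strip, Ψ p * transposeOp α Φ p = ∫ p in strip, F p * Φ p.1 p.2 := by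
  rw [integral_strip_mul_transposeOp hΨ hΦn hΦs hΦS]
  exact setIntegral_congr_fun measurableSet_strip fun p hp => by rw [heq p hp]

/-! ### Passage to the limit in the distributional identity -/

/-- `ᵗLΦ` is continuous for a test function `Φ`. [folklore] -/
theorem continuous_transposeOp (α : ℝ) {Φ : ℝ → ℝ → ℝ} (hΦn : ∀ n : ℕ, ContDiff ℝ n (uncurry Φ))
    (hΦS : tsupport (uncurry Φ) ⊆ strip) : Continuous (transposeOp α Φ) := by
  have hΦ2 : ContDiff ℝ 2 (uncurry Φ) := hΦn 2
  have hΦ1 : ContDiff ℝ 1 (uncurry Φ) := hΦn 1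
  have hdθ1 : ContDiff ℝ 1 (uncurry (dθ Φ)) := contDiff_dθ_of_contDiff (n := 1) hΦ2
  have cΦ : Continuous fun p : ℝ × ℝ => Φ p.1 p.2 := hΦ1.continuous
  have cdz : Continuous fun p : ℝ × ℝ => dz Φ p.1 p.2 := (contDiff_dz_of_contDiff (n := 0) hΦ1).continuous
  have cdz2 : Continuous fun p : ℝ × ℝ => dz (dz Φ) p.1 p.2 :=
    (contDiff_dz_of_contDiff (n := 0) (contDiff_dz_of_contDiff (n := 1) hΦ2)).continuous
  have cdθ2 : Continuous fun p : ℝ × ℝ => dθ (dθ Φ) p.1 p.2 := (contDiff_dθ_of_contDiff (n := 0) hdθ1).continuous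
  have ctan : Continuous fun p : ℝ × ℝ => Real.tan p.2 * dθ Φ p.1 p.2 :=
    continuous_tan_mul_test hdθ1 fun p hp => hΦS (tsupport_dθ_subset' Φ hp)
  have e : transposeOp α Φ = fun p => -α ^ 2 * p.1 ^ 2 * dz (dz Φ) p.1 p.2 + (5 * α - 3 * α ^ 2) * p.1 * dz Φ p.1 p.2 - dθ (dθ Φ) p.1 p.2 -
      Real.tan p.2 * dθ Φ p.1 p.2 + (5 * α - α ^ 2 - 6) * Φ p.1 p.2 := by funext p; rw [transposeOp_apply]
  rw [e]
  exact ((((by fun_prop : Continuous fun p : ℝ × ℝ => -α ^ 2 * p.1 ^ 2 * dz (dz Φ) p.1 p.2)).add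
    (by fun_prop : Continuous fun p : ℝ × ℝ => (5 * α - 3 * α ^ 2) * p.1 * dz Φ p.1 p.2)).sub cdθ2 |>.sub ctan).add (continuous_const.mul cΦ)

/-- `ᵗLΦ` has compact support inside that of `Φ`. [folklore] -/
theorem hasCompactSupport_transposeOp (α : ℝ) {Φ : ℝ → ℝ → ℝ} (hΦs : HasCompactSupport (uncurry Φ)) : HasCompactSupport (transposeOp α Φ) :=
  HasCompactSupport.of_support_subset_isCompact hΦs.isCompact fun p hp => by
    by_contra h; exact hp (transposeOp_eq_zero_of_notMem α h)

/-- `ᵗLΦ ∈ L²(strip)` for a test function `Φ`. [folklore] -/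
theorem memLp_transposeOp (α : ℝ) {Φ : ℝ → ℝ → ℝ} (hΦn : ∀ n : ℕ, ContDiff ℝ n (uncurry Φ)) (hΦs : HasCompactSupport (uncurry Φ))
    (hΦS : tsupport (uncurry Φ) ⊆ strip) : MemLp (transposeOp α Φ) 2 stripMeasure :=
  memLp_strip_of_continuous (continuous_transposeOp α hΦn hΦS) (hasCompactSupport_transposeOp α hΦs)

/-- **The distributional identity passes to `L²(strip)`-limits**: if `∫∫ u_n·ᵗLΦ = ∫∫ f_n·Φ` for all
`n` and `u_n → u`, `f_n → f` in `L²(strip)`, then `∫∫ u·ᵗLΦ = ∫∫ f·Φ`. [folklore] -/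
theorem integral_transposeOp_of_tendsto {α : ℝ} {Φ : ℝ → ℝ → ℝ} (hΦn : ∀ n : ℕ, ContDiff ℝ n (uncurry Φ))
    (hΦs : HasCompactSupport (uncurry Φ)) (hΦS : tsupport (uncurry Φ) ⊆ strip)
    {us fs : ℕ → L2Strip} {u f : L2Strip} (hu : Tendsto us atTop (𝓝 u)) (hf : Tendsto fs atTop (𝓝 f))
    (hid : ∀ n, ∫ p in strip, (us n : ℝ × ℝ → ℝ) p * transposeOp α Φ p = ∫ p in strip, (fs n : ℝ × ℝ → ℝ) p * Φ p.1 p.2) :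
    ∫ p in strip, (u : ℝ × ℝ → ℝ) p * transposeOp α Φ p = ∫ p in strip, (f : ℝ × ℝ → ℝ) p * Φ p.1 p.2 := by
  have mT := memLp_transposeOp α hΦn hΦs hΦS
  have mΦ : MemLp (fun p : ℝ × ℝ => Φ p.1 p.2) 2 stripMeasure := memLp_strip_of_continuous (hΦn 0).continuous hΦs
  rw [← inner_toL2_eq_integral u mT, ← inner_toL2_eq_integral f mΦ]
  have h1 : Tendsto (fun n => ⟪us n, toL2 (transposeOp α Φ)⟫_ℝ) atTop (𝓝 ⟪u, toL2 (transposeOp α Φ)⟫_ℝ) := hu.inner tendsto_const_nhds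
  have h2 : Tendsto (fun n => ⟪fs n, toL2 fun p : ℝ × ℝ => Φ p.1 p.2⟫_ℝ) atTop (𝓝 ⟪f, toL2 fun p : ℝ × ℝ => Φ p.1 p.2⟫_ℝ) := hf.inner tendsto_const_nhds
  have he : (fun n => ⟪us n, toL2 (transposeOp α Φ)⟫_ℝ) = fun n => ⟪fs n, toL2 fun p : ℝ × ℝ => Φ p.1 p.2⟫_ℝ := by
    funext n; rw [inner_toL2_eq_integral _ mT, inner_toL2_eq_integral _ mΦ, hid n]
  rw [he] at h1
  exact tendsto_nhds_unique h1 h2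

/-- **Limits of classical solutions**: if `Ψ_n ∈ C^∞(strip)` solve `LΨ_n = F_n` on the strip,
`Ψ_n → u` and `F_n → f` in `L²(strip)` (as `L²` classes of the given functions), and `f` agrees a.e.
on the strip with `F ∈ C^∞(strip)`, then `u` has a smooth representative `Ψ` with `LΨ = F` on the
strip. [cite: Elgindi2021, §7.1 Proposition 7.1 and §7.5 (pp. 19, 24 of arXiv:1904.04795)] -/
theorem exists_smooth_limit_solution {α : ℝ} (hα : 0 < α) {Ψs Fs : ℕ → ℝ × ℝ → ℝ} (hΨs : ∀ n, ContDiffOn ℝ ∞ (Ψs n) strip)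
    (heq : ∀ n, ∀ p ∈ strip, ellipticOp α (fun R θ => Ψs n (R, θ)) p.1 p.2 = Fs n p)
    (mΨ : ∀ n, MemLp (Ψs n) 2 stripMeasure) (mF : ∀ n, MemLp (Fs n) 2 stripMeasure)
    {u f : L2Strip} (hu : Tendsto (fun n => toL2 (Ψs n)) atTop (𝓝 u)) (hf : Tendsto (fun n => toL2 (Fs n)) atTop (𝓝 f))
    {F : ℝ × ℝ → ℝ} (hF : ContDiffOn ℝ ∞ F strip) (hfF : ∀ᵐ p ∂(volume.restrict strip), (f : ℝ × ℝ → ℝ) p = F p) :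
    ∃ Ψ : ℝ × ℝ → ℝ, ContDiffOn ℝ ∞ Ψ strip ∧ (∀ᵐ y ∂(volume : Measure (ℝ × ℝ)), y ∈ strip → (u : ℝ × ℝ → ℝ) y = Ψ y) ∧
      ∀ p ∈ strip, ellipticOp α (fun R θ => Ψ (R, θ)) p.1 p.2 = F p := by
  have hsol : ∀ Φ : ℝ → ℝ → ℝ, (∀ n : ℕ, ContDiff ℝ n (uncurry Φ)) → HasCompactSupport (uncurry Φ) → tsupport (uncurry Φ) ⊆ strip →
      ∫ p in strip, (u : ℝ × ℝ → ℝ) p * transposeOp α Φ p = ∫ p in strip, F p * Φ p.1 p.2 := by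
    intro Φ hΦn hΦs hΦS
    have hid : ∀ n, ∫ p in strip, (toL2 (Ψs n) : ℝ × ℝ → ℝ) p * transposeOp α Φ p = ∫ p in strip, (toL2 (Fs n) : ℝ × ℝ → ℝ) p * Φ p.1 p.2 := by
      intro n
      have e1 : ∫ p in strip, (toL2 (Ψs n) : ℝ × ℝ → ℝ) p * transposeOp α Φ p = ∫ p in strip, Ψs n p * transposeOp α Φ p :=
        integral_congr_ae (by filter_upwards [toL2_ae_eq' (mΨ n)] with p hp; rw [hp])
      have e2 : ∫ p in strip, (toL2 (Fs n) : ℝ × ℝ → ℝ) p * Φ p.1 p.2 = ∫ p in strip, Fs n p * Φ p.1 p.2 :=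
        integral_congr_ae (by filter_upwards [toL2_ae_eq' (mF n)] with p hp; rw [hp])
      rw [e1, e2]; exact integral_classical_transposeOp (hΨs n) (heq n) hΦn hΦs hΦS
    have h := integral_transposeOp_of_tendsto hΦn hΦs hΦS hu hf hid
    rw [h]
    exact integral_congr_ae (by filter_upwards [hfF] with p hp; rw [hp])
  have hloc : LocallyIntegrableOn (u : ℝ × ℝ → ℝ) strip volume := by
    rw [locallyIntegrableOn_iff isOpen_strip.isLocallyClosed]
    intro k hk hkc
    have h1 : MemLp (u : ℝ × ℝ → ℝ) 2 (volume.restrict k) := by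
      have h : MemLp (u : ℝ × ℝ → ℝ) 2 ((volume.restrict strip).restrict k) := (Lp.memLp u).restrict k
      rw [Measure.restrict_restrict hkc.measurableSet, inter_eq_left.2 hk] at h
      exact h
    haveI : IsFiniteMeasure (volume.restrict k) := isFiniteMeasure_restrict.2 hkc.measure_lt_top.ne
    exact h1.integrable one_le_two
  obtain ⟨Ψ, hΨ, hae⟩ := exists_smooth_rep_of_distrib hα hF hloc hsol
  exact ⟨Ψ, hΨ, hae, ellipticOp_rep_of_distrib hF hsol hΨ hae⟩

end Elgindi

end Literature.Analysis.FluidPDE
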